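import Summits.NavierStokesRegularity.OSWSelfSimilar.SheetRWeakToStrongAE
import Mathlib.Analysis.Calculus.Deriv.Shift
import HarnessLib

/-!
# SHEET-ℝ weak→classical bridge, parity step: testing the weak profile equation against ODD test functions suffices for an odd profile

HONEST FRAMING (cell ns-blowup GROUP B / zone Z3, case Z3-SR-CERT; 1-D MODEL (viscous gCLM/OSW on the line); not Euler/NS;
«violates: none — MODEL»). Nothing here asserts that a profile exists.

The certificate's energy space `E` consists of ODD functions, so its conclusion «`G(Ω*) = 0` in `E*`» only pairs `G(Ω*)` with ODD test
functions, whereas the bridge `SheetRWeakToStrong.contDiff_two_and_strongZero_of_weakZero` asks for the weak equation (W) against ALL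
`ψ ∈ C_c^∞(ℝ)`.  This file closes that gap by parity: for `Ω` odd and `Ω₁` even (pointwise), `HΩ` is even, `𝒰Ω = ∫₀HΩ` is odd, so the
right-hand side `F = Ω + ½ξΩ₁ + a𝒰Ω·Ω₁ − HΩ·Ω` is ODD (`rhs_neg`); against an EVEN test function both `∫Fψ` and `∫Ω₁ψ′` vanish identically
(`weakPairing_eq_zero_of_even`), and every test function is its even part plus its odd part.  Hence (W) for odd tests ⇒ (W) for all tests
(`weakZero_of_odd_tests`), and the bridge and blow-up theorems follow from the odd-tested hypothesis (`exact_viscous_selfSimilar_blowup_of_odd_tests`).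
Pure calculus; no definition, no named fact.  WHAT THIS IS NOT: not NS; not the MODEL ASSEMBLY.
-/

noncomputable section

namespace Summit.NavierStokesRegularity.OSWSelfSimilar
namespace SheetRWeakZeroParity

open _root_.MeasureTheory _root_.Set _root_.Filter _root_.Function Literature.Analysis.Fourier Literature.Analysis.FluidPDE
  SheetRWeakProfilePV SheetRWeakToStrong
open scoped Real Topology ContDiff

/-- The integral over `ℝ` of an odd function vanishes (whether or not it is integrable). [folklore] -/
theorem integral_eq_zero_of_odd {f : ℝ → ℝ} (hf : ∀ x, f (-x) = -f x) : ∫ x, f x = 0 := by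
  have h1 : ∫ x, f (-x) = ∫ x, f x := integral_neg_eq_self f volume
  have h2 : ∫ x, f (-x) = -∫ x, f x := by
    rw [← integral_neg]; exact integral_congr_ae (Eventually.of_forall fun x => hf x)
  linarith

/-- For odd `Ω`, the velocity `𝒰Ω(ξ) = ∫₀^ξ HΩ` is odd (`HΩ` being even). [folklore] -/
theorem velocity_neg_of_odd {Ω : ℝ → ℝ} (hodd : ∀ y, Ω (-y) = -Ω y) (x : ℝ) :
    ∫ s in (0 : ℝ)..(-x), hilbertTransform Ω s = -∫ s in (0 : ℝ)..x, hilbertTransform Ω s := by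
  have heven : ∀ s, hilbertTransform Ω (-s) = hilbertTransform Ω s := fun s => hilbertTransform_neg_arg_of_odd hodd s
  have h1 : ∫ s in (0 : ℝ)..x, hilbertTransform Ω s = ∫ s in (0 : ℝ)..x, hilbertTransform Ω (-s) :=
    intervalIntegral.integral_congr fun s _ => (heven s).symm
  rw [h1, intervalIntegral.integral_comp_neg, neg_zero, intervalIntegral.integral_symm]

/-- **The right-hand side is odd**: for `Ω` odd and `Ω₁` even, `F = Ω + ½ξΩ₁ + a𝒰Ω·Ω₁ − HΩ·Ω` satisfies `F(−x) = −F(x)`. [folklore] -/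
theorem rhs_neg {a : ℝ} {Ω Ω₁ : ℝ → ℝ} (hodd : ∀ y, Ω (-y) = -Ω y) (heven : ∀ y, Ω₁ (-y) = Ω₁ y) (x : ℝ) :
    Ω (-x) + 1 / 2 * (-x) * Ω₁ (-x) + a * (∫ s in (0 : ℝ)..(-x), hilbertTransform Ω s) * Ω₁ (-x)
        - hilbertTransform Ω (-x) * Ω (-x)
      = -(Ω x + 1 / 2 * x * Ω₁ x + a * (∫ s in (0 : ℝ)..x, hilbertTransform Ω s) * Ω₁ x - hilbertTransform Ω x * Ω x) := by
  rw [hodd, heven, velocity_neg_of_odd hodd, hilbertTransform_neg_arg_of_odd hodd]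
  ring

/-- Against an EVEN test function the weak pairing of an odd profile vanishes identically: `∫Fψ = 0` and `∫Ω₁ψ′ = 0`. [folklore] -/
theorem weakPairing_eq_zero_of_even {a ν : ℝ} {Ω Ω₁ ψ : ℝ → ℝ} (hodd : ∀ y, Ω (-y) = -Ω y) (heven : ∀ y, Ω₁ (-y) = Ω₁ y)
    (hψ : ∀ y, ψ (-y) = ψ y) :
    (∫ x, (Ω x + 1 / 2 * x * Ω₁ x + a * (∫ s in (0 : ℝ)..x, hilbertTransform Ω s) * Ω₁ x
        - hilbertTransform Ω x * Ω x) * ψ x) + ν * ∫ x, Ω₁ x * deriv ψ x = 0 := by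
  have h1 : ∫ x, (Ω x + 1 / 2 * x * Ω₁ x + a * (∫ s in (0 : ℝ)..x, hilbertTransform Ω s) * Ω₁ x
      - hilbertTransform Ω x * Ω x) * ψ x = 0 :=
    integral_eq_zero_of_odd fun x => by rw [rhs_neg hodd heven x, hψ]; ring
  have hdψ : ∀ x, deriv ψ (-x) = -deriv ψ x := by
    intro x
    have e : (fun y => ψ (-y)) = ψ := funext hψ
    have := deriv_comp_neg (f := ψ) (x := x)
    rw [e] at this
    linarith
  have h2 : ∫ x, Ω₁ x * deriv ψ x = 0 := integral_eq_zero_of_odd fun x => by rw [heven, hdψ]; ring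
  rw [h1, h2, mul_zero, add_zero]

/-- **Odd tests suffice.** For an `H¹`-type profile `Ω = Ω(0) + ∫₀Ω₁` (`Ω₁ ∈ L²`, `Ω ∈ L¹ ∩ L²`) with `Ω` odd and `Ω₁` even, the weak
profile equation (W) against all ODD `C_c^∞` tests implies (W) against ALL `C_c^∞` tests (split `ψ` into even and odd parts; the even part
pairs to zero by `weakPairing_eq_zero_of_even`). [folklore] -/
theorem weakZero_of_odd_tests {a ν : ℝ} {Ω Ω₁ : ℝ → ℝ} (hodd : ∀ y, Ω (-y) = -Ω y) (heven : ∀ y, Ω₁ (-y) = Ω₁ y)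
    (hΩ : ∀ x, Ω x = Ω 0 + ∫ s in (0 : ℝ)..x, Ω₁ s) (hΩ₁ : MemLp Ω₁ 2) (hΩi : Integrable Ω) (hΩ2 : MemLp Ω 2)
    (hweak : ∀ ψ : ℝ → ℝ, ContDiff ℝ ∞ ψ → HasCompactSupport ψ → (∀ y, ψ (-y) = -ψ y) →
      (∫ x, (Ω x + 1 / 2 * x * Ω₁ x + a * (∫ s in (0 : ℝ)..x, hilbertTransform Ω s) * Ω₁ x
        - hilbertTransform Ω x * Ω x) * ψ x) + ν * ∫ x, Ω₁ x * deriv ψ x = 0) :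
    ∀ ψ : ℝ → ℝ, ContDiff ℝ ∞ ψ → HasCompactSupport ψ →
      (∫ x, (Ω x + 1 / 2 * x * Ω₁ x + a * (∫ s in (0 : ℝ)..x, hilbertTransform Ω s) * Ω₁ x
        - hilbertTransform Ω x * Ω x) * ψ x) + ν * ∫ x, Ω₁ x * deriv ψ x = 0 := by
  intro ψ hψ hψc
  set F : ℝ → ℝ := fun x => Ω x + 1 / 2 * x * Ω₁ x
      + a * (∫ s in (0 : ℝ)..x, hilbertTransform Ω s) * Ω₁ x - hilbertTransform Ω x * Ω x with hFdef
  -- even and odd parts of the test function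
  set ψe : ℝ → ℝ := fun x => 2⁻¹ * (ψ x + ψ (-x)) with hψe
  set ψo : ℝ → ℝ := fun x => 2⁻¹ * (ψ x - ψ (-x)) with hψo
  have hneg : ContDiff ℝ ∞ fun x => ψ (-x) := hψ.comp contDiff_neg
  have hnegc : HasCompactSupport fun x => ψ (-x) := hψc.comp_homeomorph (Homeomorph.neg ℝ)
  have hψes : ContDiff ℝ ∞ ψe := contDiff_const.mul (hψ.add hneg)
  have hψos : ContDiff ℝ ∞ ψo := contDiff_const.mul (hψ.sub hneg)
  have hψec : HasCompactSupport ψe := (hψc.add hnegc).mul_left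
  have hψoc : HasCompactSupport ψo := (hψc.sub hnegc).mul_left
  have hψe_even : ∀ y, ψe (-y) = ψe y := fun y => by simp only [hψe, neg_neg]; ring
  have hψo_odd : ∀ y, ψo (-y) = -ψo y := fun y => by simp only [hψo, neg_neg]; ring
  have hsum : ∀ x, ψ x = ψe x + ψo x := fun x => by simp only [hψe, hψo]; ring
  have hdsum : ∀ x, deriv ψ x = deriv ψe x + deriv ψo x := by
    intro x
    have hde : Differentiable ℝ ψe := hψes.differentiable (by simp)
    have hdo : Differentiable ℝ ψo := hψos.differentiable (by simp)
    have e : ψ = fun x => ψe x + ψo x := funext hsum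
    conv_lhs => rw [e]
    exact deriv_add (hde x) (hdo x)
  -- integrability of the four pairings (F ∈ L¹_loc, Ω₁ ∈ L¹_loc; tests continuous with compact support)
  have hFloc : LocallyIntegrable F := locallyIntegrable_rhs hΩ hΩ₁ hΩi hΩ2
  have hΩ₁loc : LocallyIntegrable Ω₁ := hΩ₁.locallyIntegrable one_le_two
  have hiF : ∀ χ : ℝ → ℝ, Continuous χ → HasCompactSupport χ → Integrable fun x => F x * χ x := fun χ hχ hχc => by
    simpa only [smul_eq_mul] using hFloc.integrable_smul_right_of_hasCompactSupport hχ hχc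
  have hiD : ∀ χ : ℝ → ℝ, ContDiff ℝ ∞ χ → HasCompactSupport χ → Integrable fun x => Ω₁ x * deriv χ x := fun χ hχ hχc => by
    simpa only [smul_eq_mul] using hΩ₁loc.integrable_smul_right_of_hasCompactSupport
      (hχ.continuous_deriv (by exact_mod_cast le_top)) hχc.deriv
  have e1 : ∫ x, F x * ψ x = (∫ x, F x * ψe x) + ∫ x, F x * ψo x := by
    rw [← integral_add (hiF ψe hψes.continuous hψec) (hiF ψo hψos.continuous hψoc)]
    exact integral_congr_ae (Eventually.of_forall fun x => by simp only [hsum x]; ring)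
  have e2 : ∫ x, Ω₁ x * deriv ψ x = (∫ x, Ω₁ x * deriv ψe x) + ∫ x, Ω₁ x * deriv ψo x := by
    rw [← integral_add (hiD ψe hψes hψec) (hiD ψo hψos hψoc)]
    exact integral_congr_ae (Eventually.of_forall fun x => by simp only [hdsum x]; ring)
  have hE := weakPairing_eq_zero_of_even (a := a) (ν := ν) hodd heven hψe_even
  have hO := hweak ψo hψos hψoc hψo_odd
  show (∫ x, F x * ψ x) + ν * ∫ x, Ω₁ x * deriv ψ x = 0
  rw [e1, e2]
  change (∫ x, F x * ψe x) + ν * ∫ x, Ω₁ x * deriv ψe x = 0 at hE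
  change (∫ x, F x * ψo x) + ν * ∫ x, Ω₁ x * deriv ψo x = 0 at hO
  linarith

/-- **Bridge from the odd-tested weak zero.** An odd `H¹`-type profile (`Ω₁` even, `Ω₁ ∈ L²`, `Ω ∈ L¹ ∩ L²`, `ν ≠ 0`) satisfying (W) against
all ODD `C_c^∞` tests — the literal content of «`G(Ω) = 0` in `E*`» for the odd energy space `E` — is `C²` and a pointwise zero of the
certificate's map. MODEL statement. [folklore] -/
theorem contDiff_two_and_strongZero_of_odd_tests {a ν : ℝ} {Ω Ω₁ : ℝ → ℝ} (hν : ν ≠ 0)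
    (hodd : ∀ y, Ω (-y) = -Ω y) (heven : ∀ y, Ω₁ (-y) = Ω₁ y)
    (hΩ : ∀ x, Ω x = Ω 0 + ∫ s in (0 : ℝ)..x, Ω₁ s) (hΩ₁ : MemLp Ω₁ 2) (hΩi : Integrable Ω) (hΩ2 : MemLp Ω 2)
    (hweak : ∀ ψ : ℝ → ℝ, ContDiff ℝ ∞ ψ → HasCompactSupport ψ → (∀ y, ψ (-y) = -ψ y) →
      (∫ x, (Ω x + 1 / 2 * x * Ω₁ x + a * (∫ s in (0 : ℝ)..x, hilbertTransform Ω s) * Ω₁ x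
        - hilbertTransform Ω x * Ω x) * ψ x) + ν * ∫ x, Ω₁ x * deriv ψ x = 0) :
    ContDiff ℝ 2 Ω ∧ ∀ X : ℝ, Ω X + 1 / 2 * X * deriv Ω X
      + a * (∫ s in (0 : ℝ)..X, hilbertTransform Ω s) * deriv Ω X
      - hilbertTransform Ω X * Ω X - ν * iteratedDeriv 2 Ω X = 0 :=
  contDiff_two_and_strongZero_of_weakZero hν hΩ hΩ₁ hΩi hΩ2 (weakZero_of_odd_tests hodd heven hΩ hΩ₁ hΩi hΩ2 hweak)

/-- **Blow-up from the odd-tested weak zero.** Under the hypotheses of `contDiff_two_and_strongZero_of_odd_tests`, if `Ω ≢ 0`, then for every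
`T > 0` the self-similar function `ω(t,x) = (T − t)⁻¹Ω(x/√(T − t))` is a classical solution of `ω_t + a u ω_x = u_x ω + ν ω_xx` on `ℝ × [0,T)`
whose sup norm blows up at `T`. MODEL statement; no profile is asserted to exist. [folklore] -/
theorem exact_viscous_selfSimilar_blowup_of_odd_tests {a ν T : ℝ} {Ω Ω₁ : ℝ → ℝ} (hT : 0 < T) (hν : ν ≠ 0)
    (hodd : ∀ y, Ω (-y) = -Ω y) (heven : ∀ y, Ω₁ (-y) = Ω₁ y)
    (hΩ : ∀ x, Ω x = Ω 0 + ∫ s in (0 : ℝ)..x, Ω₁ s) (hΩ₁ : MemLp Ω₁ 2) (hΩi : Integrable Ω) (hΩ2 : MemLp Ω 2)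
    (hweak : ∀ ψ : ℝ → ℝ, ContDiff ℝ ∞ ψ → HasCompactSupport ψ → (∀ y, ψ (-y) = -ψ y) →
      (∫ x, (Ω x + 1 / 2 * x * Ω₁ x + a * (∫ s in (0 : ℝ)..x, hilbertTransform Ω s) * Ω₁ x
        - hilbertTransform Ω x * Ω x) * ψ x) + ν * ∫ x, Ω₁ x * deriv ψ x = 0)
    {X₀ : ℝ} (hX₀ : Ω X₀ ≠ 0) :
    IsGCLMLineSolution a ν (gclmSelfSimilar (-1) (1 / 2) T Ω) T ∧
      SupNormBlowupBefore (gclmSelfSimilar (-1) (1 / 2) T Ω) T :=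
  exact_viscous_selfSimilar_blowup_of_weakZero hT hν hΩ hΩ₁ hΩi hΩ2 (weakZero_of_odd_tests hodd heven hΩ hΩ₁ hΩi hΩ2 hweak) hX₀

end SheetRWeakZeroParity
end Summit.NavierStokesRegularity.OSWSelfSimilar

end
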